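import Mathlib.NumberTheory.LegendreSymbol.Basic
import Literature.NumberTheory.EllipticCurves.ComplexMultiplicationHasCMProofs
import Literature.NumberTheory.EllipticCurves.SerreOpenImageDeterminantProofs
import Literature.NumberTheory.GaloisRepresentations.AbsGaloisGroup
import Literature.NumberTheory.GaloisRepresentations.SerreCartanSubgroupsGL2FpProofs
import HarnessLib

/-!
# The mod `ℓ` image of an elliptic curve with `j = 1728` lies in the normaliser of a non-split
# Cartan subgroup for `ℓ ≡ 3 (mod 4)` (Darmon–Merel 1997, Prop. 4.1 (1), containment) — proofs

Topic `Literature/NumberTheory/EllipticCurves`. Theorems only (no definition, no named fact, no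
`sorry`). Source: H. Darmon, L. Merel, *Winding quotients and some variants of Fermat's Last
Theorem*, J. reine angew. Math. 490 (1997), 81–100, §4 (p. 10 of the authors' 26-page version):

> *`X₀(32) : Y² = X³ − X` … Both of these curves have complex multiplication: `X₀(32)` by the ring
> of Gaussian integers `ℤ[i]` … Let `G` be the image of `ρ` in `GL₂(𝔽_p)`. Proposition 4.1. 1. In
> the case of equations (1) and (2), the group `G` is the normalizer of a Cartan subgroup of
> `GL₂(𝔽_p)`. This Cartan subgroup is split if `p ≡ 1 (mod 4)`, and is non-split if
> `p ≡ −1 (mod 4)`. Moreover, the field cut out by `ρ` is an abelian extension of `ℚ(i)`.*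

(there `ρ ≅ X₀(32)[p]`, `p ≥ 7`; the proof offered is "the theory of complex multiplication").
This file PROVES the elementary half of part 1 in the non-split case, for every curve
`E_D : y² = x³ + Dx` over `ℚ` (`D ≠ 0`; `X₀(32)` is `D = −1`, and up to `ℚ`-isomorphism every
curve with `j = 1728` is of this form) and every prime `ℓ` with `−1` a non-square mod `ℓ` (i.e.
`ℓ ≡ 3 (mod 4)`):
**the image `G_ℓ` of `ρ̄_{E_D,ℓ}` is contained in the normaliser of a non-split Cartan subgroup
`C = 𝔽_ℓ[t]ˣ` of `GL₂(𝔽_ℓ)`, and `ρ̄(σ) ∈ C` for every `σ` fixing `i`** (so `ρ̄(Gal(ℚ̄/ℚ(i))) ⊆ C`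
is abelian). The equality `G = N(C)` asserted in the source (surjectivity onto the normaliser,
class field theory of `ℚ(i)`) is NOT proved here.

The argument is the classical one for a curve with complex multiplication (the Galois group
commutes with `[i]` over `ℚ(i)` and conjugates it to `[−i] = −[i]` otherwise), in the vocabulary of
Cartan subgroups of Serre 1972, §2.1–2.2 (`SerreCartanSubgroupsGL2Fp{,Proofs}`):

* `WeierstrassCurve.exists_cmAut_quartic` — the automorphism `[i] : (x, y) ↦ (−x, iy)` of
  `E_D` over `ℚ̄` (the change of variables `(u, 0, 0, 0)`, `u² = −1`; cf.
  `WeierstrassCurve.smul_ofJ1728_eq`, Silverman *AEC* III.10.1) as an additive automorphism `ι`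
  of `E_D(ℚ̄)` with `ι ∘ ι = −1` and the twisting rule `σ ∘ ι = ι ∘ σ` if `σ(i) = i`,
  `σ ∘ ι = −ι ∘ σ` if `σ(i) = −i` (`σ ∈ Gal(ℚ̄/ℚ)`), computed on coordinates.
* `WeierstrassCurve.exists_unitGroup_of_cmAut` — **the abstract statement**: for any elliptic
  `W/ℚ`, any `ι` with these two properties, any prime `ℓ` with `−1` non-square in `𝔽_ℓ` and any
  frame `(e, Φ)` of `E[ℓ]` (`SerreOpenImageDeterminantProofs.exists_frame_galoisRepTorsion_rat`),
  the matrix `t = Φ(ι|E[ℓ])` satisfies `t² = −1`, is non-scalar, `k = 𝔽_ℓ[t]` is a field of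
  degree `2` (`Serre1972.isField_adjoinElem`), every `g = Φ(ρ̄(σ))` conjugates `t` to `±t` and hence
  normalises `kˣ` (`Serre1972.conj_mem_adjoinElem`, `adjoinElem_eq_of_mem`), and commutes with `t`,
  hence lies in `kˣ` (`DeligneSerre1974.TwoByTwo.exists_eq_smul_one_add_smul_of_commute`), when
  `σ(i) = i`.
* `WeierstrassCurve.exists_unitGroup_quartic` — the two combined for `E_D` (any frame), and
  `WeierstrassCurve.exists_frame_unitGroup_quartic` with the frame supplied by
  `exists_frame_galoisRepTorsion_rat` (`…_of_mod_four`: under `ℓ ≡ 3 (mod 4)`);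
  `WeierstrassCurve.galoisRepTorsion_quartic_comm_of_smul_eq` — frame-free: `ρ̄(σ)`, `ρ̄(τ)`
  commute for `σ, τ` fixing `i` ("the field cut out by `ρ` is an abelian extension of `ℚ(i)`").

## References

* H. Darmon, L. Merel, J. reine angew. Math. 490 (1997), §4, Prop. 4.1 (1). [DarmonMerel1997]
* J.-P. Serre, *Propriétés galoisiennes des points d'ordre fini des courbes elliptiques*, Invent.
  Math. 15 (1972), §2.1–2.2 (Cartan subgroups; as read for `SerreCartanSubgroupsGL2Fp`).
  [Serre1972]
* J. H. Silverman, *The Arithmetic of Elliptic Curves*, 2nd ed., III.10.1 (`Aut E` for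
  `j = 1728`), III Example 4.4. [SilvermanAEC2009]
-/

noncomputable section

open scoped Classical MatrixGroups
open Matrix

universe u

namespace WeierstrassCurve

open Literature.NumberTheory.EllipticCurves Literature.NumberTheory.GaloisRepresentations
  Literature.NumberTheory.GaloisRepresentations.Serre1972

/-! ### The Galois action on an affine geometric point (coordinatewise) -/

section SmulSome

variable {F : Type u} [Field F] (W : WeierstrassCurve F)

/-- The action of `σ ∈ Γ_F` on an affine point of `E(F̄)` is coordinatewise
(`GaloisAction`: `σ • P = Point.map σ P`; Mathlib `Affine.Point.map_some`). [folklore] -/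
theorem geomPoints_smul_some (σ : Field.absoluteGaloisGroup F) {x y : AlgebraicClosure F}
    (h : (W.baseChange (AlgebraicClosure F)).toAffine.Nonsingular x y) :
    ∃ h' : (W.baseChange (AlgebraicClosure F)).toAffine.Nonsingular (σ • x) (σ • y),
      @HSMul.hSMul (Field.absoluteGaloisGroup F) (geomPoints W) (geomPoints W) _ σ
          (.some x y h) = .some (σ • x) (σ • y) h' :=
  ⟨_, by
    change Affine.Point.map
      ((Field.absoluteGaloisGroup.toAlgEquiv F σ : AlgebraicClosure F ≃ₐ[F] AlgebraicClosure F) :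
        AlgebraicClosure F →ₐ[F] AlgebraicClosure F) (.some x y h) = _
    rw [Affine.Point.map_some]
    rfl⟩

/-- Negation of an affine point of `E(F̄)`, in the type synonym `geomPoints W`:
`−(x, y) = (x, −y − a₁x − a₃)` (Mathlib `Affine.Point.neg_some`, definitionally). [folklore] -/
theorem geomPoints_neg_some {x y : AlgebraicClosure F}
    (h : (W.baseChange (AlgebraicClosure F)).toAffine.Nonsingular x y) :
    -(Affine.Point.some x y h : geomPoints W) =
      Affine.Point.some x ((W.baseChange (AlgebraicClosure F)).toAffine.negY x y)
        ((Affine.nonsingular_neg ..).mpr h) :=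
  rfl

end SmulSome

/-! ### The automorphism `[i]` of `y² = x³ + Dx` and its Galois twisting -/

section Quartic

variable {D : ℚ}

/-- `(y² = x³ + Dx)_{ℚ̄}` has coefficients `(0, 0, 0, D, 0)`. [folklore] -/
theorem baseChange_quartic :
    (⟨0, 0, 0, D, 0⟩ : WeierstrassCurve ℚ).baseChange (AlgebraicClosure ℚ) = ⟨0, 0, 0, (D : AlgebraicClosure ℚ), 0⟩ := by
  simp only [baseChange, map]
  ext <;> simp

/-- `y² = x³ + Dx` is an elliptic curve for `D ≠ 0` (`Δ = −64 D³`). [folklore] -/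
theorem isElliptic_quartic (hD : D ≠ 0) : (⟨0, 0, 0, D, 0⟩ : WeierstrassCurve ℚ).IsElliptic := by
  refine ⟨?_⟩
  have : (⟨0, 0, 0, D, 0⟩ : WeierstrassCurve ℚ).Δ = -64 * D ^ 3 := by
    simp only [WeierstrassCurve.Δ, WeierstrassCurve.b₂, WeierstrassCurve.b₄, WeierstrassCurve.b₆,
      WeierstrassCurve.b₈]
    ring
  rw [this, isUnit_iff_ne_zero]
  exact mul_ne_zero (by norm_num) (pow_ne_zero 3 hD)

/-- For `u² = −1` the change of variables `(u, 0, 0, 0)`, i.e. `(x, y) ↦ (u⁻²x, u⁻³y) = (−x, uy)`,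
is an automorphism of `y² = x³ + Dx` over `ℚ̄` (`a₄' = u⁻⁴ a₄ = a₄`). Silverman, *AEC*, III.10.1
(proof, `j = 1728`); cf. `WeierstrassCurve.smul_ofJ1728_eq`. [cite: SilvermanAEC2009, Thm. III.10.1] -/
theorem smul_quartic_eq {u : (AlgebraicClosure ℚ)} (hu : u ^ 2 = -1) (hu0 : u ≠ 0) :
    (⟨Units.mk0 u hu0, 0, 0, 0⟩ : VariableChange (AlgebraicClosure ℚ)) •
        (⟨0, 0, 0, D, 0⟩ : WeierstrassCurve ℚ).baseChange (AlgebraicClosure ℚ) =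
      (⟨0, 0, 0, D, 0⟩ : WeierstrassCurve ℚ).baseChange (AlgebraicClosure ℚ) := by
  rw [baseChange_quartic]
  have hu4 : u ^ 4 = 1 := by
    calc u ^ 4 = (u ^ 2) ^ 2 := by ring
      _ = 1 := by rw [hu]; norm_num
  have hinv : (u⁻¹) ^ 4 = 1 := by rw [inv_pow, hu4, inv_one]
  simp only [variableChange_def]
  ext
  · simp
  · simp
  · simp
  · simp only [Units.val_inv_eq_inv_val, Units.val_mk0, hinv]
    ring
  · simp

/-- **The CM automorphism `[i]` of `E_D : y² = x³ + Dx` and its Galois twisting.** For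
`u ∈ ℚ̄` with `u² = −1` there is an additive automorphism `ι` of `E_D(ℚ̄)` — the `ℚ̄`-automorphism
`[i] : (x, y) ↦ (−x, uy)` attached to the change of variables `(u, 0, 0, 0)` — such that
`ι(ι(P)) = −P`, `σ(ι(P)) = ι(σ(P))` for every `σ ∈ Gal(ℚ̄/ℚ)` with `σ(u) = u`, and
`σ(ι(P)) = −ι(σ(P))` for every `σ` with `σ(u) = −u` (on coordinates: `σ(−x, uy) = (−σx, σ(u) σy)`).
This is the input "`X₀(32)` has complex multiplication by `ℤ[i]`" of Darmon–Merel §4 in the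
form used for Prop. 4.1; Silverman *AEC* III Example 4.4, III.10.1.
[cite: DarmonMerel1997, §4 (p. 10)] [cite: SilvermanAEC2009, III Example 4.4] -/
theorem exists_cmAut_quartic {u : (AlgebraicClosure ℚ)} (hu : u ^ 2 = -1) :
    ∃ ι : geomPoints (⟨0, 0, 0, D, 0⟩ : WeierstrassCurve ℚ) ≃+
        geomPoints (⟨0, 0, 0, D, 0⟩ : WeierstrassCurve ℚ),
      (∀ P, ι (ι P) = -P) ∧
      (∀ σ : Field.absoluteGaloisGroup ℚ, σ • u = u → ∀ P, σ • ι P = ι (σ • P)) ∧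
      (∀ σ : Field.absoluteGaloisGroup ℚ, σ • u = -u → ∀ P, σ • ι P = -ι (σ • P)) := by
  set W : WeierstrassCurve ℚ := ⟨0, 0, 0, D, 0⟩ with hW
  have hu0 : u ≠ 0 := by
    rintro rfl
    rw [zero_pow two_ne_zero, zero_eq_neg] at hu
    exact one_ne_zero hu
  have huinv : u⁻¹ = -u := inv_eq_of_mul_eq_one_right (by linear_combination -hu)
  have hu2 : u⁻¹ ^ 2 = -1 := by rw [huinv, neg_sq, hu]
  have hu3 : u⁻¹ ^ 3 = u := by
    rw [huinv, show (-u) ^ 3 = -(u * u ^ 2) by ring, hu]; ring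
  set C : VariableChange (AlgebraicClosure ℚ) := ⟨Units.mk0 u hu0, 0, 0, 0⟩ with hC
  have hCW : C • W.baseChange (AlgebraicClosure ℚ) = W.baseChange (AlgebraicClosure ℚ) := smul_quartic_eq hu hu0
  have hCu : ((C.u⁻¹ : (AlgebraicClosure ℚ)ˣ) : AlgebraicClosure ℚ) = u⁻¹ := by simp [hC]
  have htoX : ∀ x : (AlgebraicClosure ℚ), C.toX x = -x := by
    intro x; rw [VariableChange.toX_def, hCu, hu2]; simp [hC]
  have htoY : ∀ x y : (AlgebraicClosure ℚ), C.toY x y = u * y := by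
    intro x y; rw [VariableChange.toY_def, hCu, hu3]; simp [hC]
  -- coefficients of the base-changed curve
  have ha₁ : (W.baseChange (AlgebraicClosure ℚ)).a₁ = 0 := by rw [hW, baseChange_quartic]
  have ha₃ : (W.baseChange (AlgebraicClosure ℚ)).a₃ = 0 := by rw [hW, baseChange_quartic]
  have hnegY : ∀ x y : (AlgebraicClosure ℚ), (W.baseChange (AlgebraicClosure ℚ)).toAffine.negY x y = -y := by
    intro x y
    simp only [Affine.negY, toAffine, ha₁, ha₃]
    ring
  obtain ⟨ι, hι⟩ : ∃ ι : geomPoints W ≃+ geomPoints W,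
      ι = (VariableChange.pointEquiv (W.baseChange (AlgebraicClosure ℚ)) C).trans (Affine.Point.congrEquiv hCW) :=
    ⟨_, rfl⟩
  -- `ι` on an affine point
  have hιsome : ∀ {x y : (AlgebraicClosure ℚ)} (h : (W.baseChange (AlgebraicClosure ℚ)).toAffine.Nonsingular x y),
      ∃ h', ι (.some x y h) = .some (-x) (u * y) h' := by
    intro x y h
    have e := pointEquiv_trans_congrEquiv_some (W₁ := W) (W₂ := W) C hCW h
    rw [hι]
    refine ⟨?_, e.trans ?_⟩
    · have h' := (hCW ▸ (VariableChange.nonsingular_iff (W.baseChange (AlgebraicClosure ℚ)) C x y).mpr h)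
      rwa [htoX, htoY] at h'
    · congr 1
      · exact htoX x
      · exact htoY x y
  refine ⟨ι, ?_, ?_, ?_⟩
  · -- `ι ∘ ι = -1`
    rintro (_ | ⟨x, y, h⟩)
    · change ι (ι 0) = -0
      rw [map_zero, map_zero, neg_zero]
    · obtain ⟨h1, e1⟩ := hιsome h
      obtain ⟨h2, e2⟩ := hιsome h1
      rw [e1, e2]
      change (Affine.Point.some (- -x) (u * (u * y)) h2 : (W.baseChange (AlgebraicClosure ℚ)).toAffine.Point) =
        -Affine.Point.some x y h
      rw [Affine.Point.neg_some]
      congr 1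
      · ring
      · exact (by rw [← mul_assoc, ← sq, hu]; ring : u * (u * y) = -y).trans (hnegY x y).symm
  · -- `σ u = u`
    intro σ hσ
    rintro (_ | ⟨x, y, h⟩)
    · change σ • ι 0 = ι (σ • 0)
      rw [map_zero, smul_zero, map_zero]
    · obtain ⟨h1, e1⟩ := hιsome h
      obtain ⟨h2, e2⟩ := geomPoints_smul_some W σ h
      obtain ⟨h3, e3⟩ := hιsome h2
      obtain ⟨h4, e4⟩ := geomPoints_smul_some W σ h1
      rw [e1, e4, e2, e3]
      congr 1
      · exact smul_neg σ x
      · rw [smul_mul', hσ]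
  · -- `σ u = -u`
    intro σ hσ
    rintro (_ | ⟨x, y, h⟩)
    · change σ • ι 0 = -ι (σ • 0)
      rw [map_zero, smul_zero, map_zero, neg_zero]
    · obtain ⟨h1, e1⟩ := hιsome h
      obtain ⟨h2, e2⟩ := geomPoints_smul_some W σ h
      obtain ⟨h3, e3⟩ := hιsome h2
      obtain ⟨h4, e4⟩ := geomPoints_smul_some W σ h1
      rw [e1, e4, e2, e3]
      change (Affine.Point.some (σ • -x) (σ • (u * y)) h4 : (W.baseChange (AlgebraicClosure ℚ)).toAffine.Point) =
        -Affine.Point.some (-(σ • x)) (u * σ • y) h3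
      rw [Affine.Point.neg_some]
      congr 1
      · exact smul_neg σ x
      · rw [smul_mul', hσ]
        exact (by ring : -u * σ • y = -(u * σ • y)).trans (hnegY _ _).symm

/-- Every `σ ∈ Gal(ℚ̄/ℚ)` maps a square root `u` of `−1` to `±u`. [folklore] -/
theorem smul_sqrt_neg_one_eq_or {u : (AlgebraicClosure ℚ)} (hu : u ^ 2 = -1) (σ : Field.absoluteGaloisGroup ℚ) :
    σ • u = u ∨ σ • u = -u := by
  have h : (σ • u) ^ 2 = u ^ 2 := by rw [← smul_pow', hu, smul_neg, smul_one]
  exact sq_eq_sq_iff_eq_or_eq_neg.mp h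

end Quartic

/-! ### From a CM automorphism twisted by a quadratic character to a non-split Cartan subgroup -/

section Abstract

variable (W : WeierstrassCurve ℚ) (ℓ : ℕ) [Fact ℓ.Prime]

/-- **Abstract form of Darmon–Merel 1997, Prop. 4.1 (1), containment, non-split case** (the
classical argument for a curve with complex multiplication). Let `W/ℚ` be a
Weierstrass curve, `u ∈ ℚ̄` an element moved by every `σ ∈ Gal(ℚ̄/ℚ)` to `±u`, and `ι` an additive
automorphism of `E(ℚ̄)` with `ι ∘ ι = −1`, commuting with every `σ` fixing `u` and anti-commuting
(`σ ∘ ι = −ι ∘ σ`) with every `σ` negating `u`. Let `ℓ` be a prime such that `−1` is not a square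
in `𝔽_ℓ`, and `(e, Φ)` a frame of `E[ℓ]` (`e (g x) = Φ(g) e(x)`). Then for the matrix
`t = Φ(ι|E[ℓ])`: `t² = −1`, `t` is non-scalar with `tr t = 0`, `det t = 1`, so `k = 𝔽_ℓ[t]` is a
field with `[k : 𝔽_ℓ] = 2` (`X² + 1` irreducible) and `kˣ` a non-split Cartan subgroup; every
`Φ(ρ̄(σ))` conjugates `t` to `±t`, hence normalises `kˣ`; and `Φ(ρ̄(σ))` commutes with `t`, hence
lies in `kˣ`, when `σ(u) = u`. Conclusion: the image `Φ(ρ̄_{E,ℓ}(Γ_ℚ))` is contained in the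
normaliser of the non-split Cartan subgroup `kˣ`, and `ρ̄(Gal(ℚ̄/ℚ(u))) ⊆ kˣ`.
[cite: DarmonMerel1997, Prop. 4.1 (1)] [cite: Serre1972, §2.1–2.2 (Cartan subgroups)] -/
theorem exists_unitGroup_of_cmAut (hℓ : ¬ IsSquare (-1 : ZMod ℓ)) {u : (AlgebraicClosure ℚ)}
    (hσu : ∀ σ : Field.absoluteGaloisGroup ℚ, σ • u = u ∨ σ • u = -u)
    (ι : geomPoints W ≃+ geomPoints W) (hιι : ∀ P, ι (ι P) = -P)
    (hfix : ∀ σ : Field.absoluteGaloisGroup ℚ, σ • u = u → ∀ P, σ • ι P = ι (σ • P))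
    (hneg : ∀ σ : Field.absoluteGaloisGroup ℚ, σ • u = -u → ∀ P, σ • ι P = -ι (σ • P))
    (e : geomTorsion W ℓ ≃+ (Fin 2 → ZMod ℓ))
    (Φ : Multiplicative (AddAut (geomTorsion W ℓ)) ≃* GL (Fin 2) (ZMod ℓ))
    (heΦ : ∀ (g : Multiplicative (AddAut (geomTorsion W ℓ))) (x : geomTorsion W ℓ),
      e (Multiplicative.toAdd g x) =
        ((Φ g : GL (Fin 2) (ZMod ℓ)) : Matrix (Fin 2) (Fin 2) (ZMod ℓ)) *ᵥ e x) :
    ∃ k : Subalgebra (ZMod ℓ) (Matrix (Fin 2) (Fin 2) (ZMod ℓ)),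
      IsField k ∧ Module.finrank (ZMod ℓ) k = 2 ∧
      (galoisRepTorsion W ℓ).range.map Φ.toMonoidHom ≤
        Subgroup.normalizer (unitGroup k : Set (GL (Fin 2) (ZMod ℓ))) ∧
      ∀ σ : Field.absoluteGaloisGroup ℚ, σ • u = u → Φ (galoisRepTorsion W ℓ σ) ∈ unitGroup k := by
  -- Step 0: `ι` preserves `E[ℓ]`; its restriction `T`
  have hmem : ∀ (f : geomPoints W ≃+ geomPoints W) (P : geomPoints W),
      P ∈ geomTorsion W ℓ → f P ∈ geomTorsion W ℓ := by
    intro f P hP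
    have hP' : (ℓ : ℤ) • P = 0 := (Submodule.mem_torsionBy_iff (ℓ : ℤ) P).mp hP
    exact (Submodule.mem_torsionBy_iff (ℓ : ℤ) (f P)).mpr (by rw [← map_zsmul f, hP', map_zero])
  let T : geomTorsion W ℓ ≃+ geomTorsion W ℓ :=
    { toFun := fun x ↦ ⟨ι x, hmem ι x x.2⟩
      invFun := fun x ↦ ⟨ι.symm x, hmem ι.symm x x.2⟩
      left_inv := fun x ↦ Subtype.ext (ι.symm_apply_apply (x : geomPoints W))
      right_inv := fun x ↦ Subtype.ext (ι.apply_symm_apply (x : geomPoints W))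
      map_add' := fun x y ↦ Subtype.ext (map_add ι (x : geomPoints W) y) }
  have hT : ∀ x : geomTorsion W ℓ, ((T x : geomTorsion W ℓ) : geomPoints W) = ι x := fun x ↦ rfl
  -- the matrices `t = Φ(T)` and `g_σ = Φ(ρ̄ σ)`
  set t : Matrix (Fin 2) (Fin 2) (ZMod ℓ) :=
    ((Φ (Multiplicative.ofAdd T) : GL (Fin 2) (ZMod ℓ)) : Matrix (Fin 2) (Fin 2) (ZMod ℓ)) with ht
  have heT : ∀ x : geomTorsion W ℓ, e (T x) = t *ᵥ e x := fun x ↦ by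
    simpa using heΦ (Multiplicative.ofAdd T) x
  have heσ : ∀ (σ : Field.absoluteGaloisGroup ℚ) (x : geomTorsion W ℓ),
      e (σ • x) = ((Φ (galoisRepTorsion W ℓ σ) : GL (Fin 2) (ZMod ℓ)) :
        Matrix (Fin 2) (Fin 2) (ZMod ℓ)) *ᵥ e x := fun σ x ↦ by
    simpa using heΦ (galoisRepTorsion W ℓ σ) x
  -- matrices are determined by their action on the vectors `e x`
  have hext : ∀ M N : Matrix (Fin 2) (Fin 2) (ZMod ℓ),
      (∀ x : geomTorsion W ℓ, M *ᵥ e x = N *ᵥ e x) → M = N := by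
    intro M N h
    refine Matrix.toLin'.injective (LinearMap.ext fun v ↦ ?_)
    obtain ⟨x, rfl⟩ := e.surjective v
    simpa only [Matrix.toLin'_apply] using h x
  -- (M1) `t² = -1`
  have htt : t * t = -1 := by
    refine hext _ _ fun x ↦ ?_
    have hTT : T (T x) = -x := Subtype.ext (by rw [hT, hT, hιι]; rfl)
    rw [← Matrix.mulVec_mulVec, ← heT, ← heT, hTT, map_neg, Matrix.neg_mulVec, Matrix.one_mulVec]
  -- (M2) `σ u = u`: `g_σ t = t g_σ`; (M3) `σ u = -u`: `g_σ t = -t g_σ`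
  have hcomm : ∀ σ : Field.absoluteGaloisGroup ℚ, σ • u = u →
      ((Φ (galoisRepTorsion W ℓ σ) : GL (Fin 2) (ZMod ℓ)) : Matrix (Fin 2) (Fin 2) (ZMod ℓ)) * t =
        t * ((Φ (galoisRepTorsion W ℓ σ) : GL (Fin 2) (ZMod ℓ)) :
          Matrix (Fin 2) (Fin 2) (ZMod ℓ)) := by
    intro σ hσ
    refine hext _ _ fun x ↦ ?_
    have hσT : σ • T x = T (σ • x) := Subtype.ext (by
      show σ • ((T x : geomTorsion W ℓ) : geomPoints W) =
        ι ((σ • x : geomTorsion W ℓ) : geomPoints W)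
      rw [hT]; exact hfix σ hσ x)
    simp only [← Matrix.mulVec_mulVec, ← heT, ← heσ, hσT]
  have hanti : ∀ σ : Field.absoluteGaloisGroup ℚ, σ • u = -u →
      ((Φ (galoisRepTorsion W ℓ σ) : GL (Fin 2) (ZMod ℓ)) : Matrix (Fin 2) (Fin 2) (ZMod ℓ)) * t =
        -(t * ((Φ (galoisRepTorsion W ℓ σ) : GL (Fin 2) (ZMod ℓ)) :
          Matrix (Fin 2) (Fin 2) (ZMod ℓ))) := by
    intro σ hσ
    refine hext _ _ fun x ↦ ?_
    have hσT : σ • T x = -T (σ • x) := Subtype.ext (by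
      show σ • ((T x : geomTorsion W ℓ) : geomPoints W) =
        -ι ((σ • x : geomTorsion W ℓ) : geomPoints W)
      rw [hT]; exact hneg σ hσ x)
    simp only [Matrix.neg_mulVec, ← Matrix.mulVec_mulVec, ← heT, ← heσ, hσT, map_neg]
  -- (C1) `t` is not a scalar: `c² = -1` has no solution in `𝔽_ℓ`
  have hts : ∀ c : ZMod ℓ, t ≠ c • (1 : Matrix (Fin 2) (Fin 2) (ZMod ℓ)) := by
    intro c hc
    apply hℓ
    refine ⟨c, ?_⟩
    have h00 := congrFun (congrFun htt 0) 0
    rw [hc] at h00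
    simp [Matrix.mul_apply, Fin.sum_univ_two] at h00
    linear_combination -h00
  -- `tr t = 0`, `det t = 1` (Cayley–Hamilton), so `X² - tr(t) X + det(t) = X² + 1` has no root
  have hdet : t.trace = 0 ∧ t.det = 1 := by
    have hCH := DeligneSerre1974.TwoByTwo.mul_self_eq t
    rw [htt] at hCH
    by_cases h0 : t.trace = 0
    · refine ⟨h0, ?_⟩
      rw [h0, zero_smul, zero_sub] at hCH
      have h00 := congrFun (congrFun hCH 0) 0
      simp at h00
      exact h00.symm
    · exfalso
      apply hts (t.trace⁻¹ * (t.det - 1))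
      have h1 : t.trace • t = -1 + t.det • (1 : Matrix (Fin 2) (Fin 2) (ZMod ℓ)) :=
        sub_eq_iff_eq_add.mp hCH.symm
      calc t = t.trace⁻¹ • (t.trace • t) := by rw [smul_smul, inv_mul_cancel₀ h0, one_smul]
        _ = (t.trace⁻¹ * (t.det - 1)) • (1 : Matrix (Fin 2) (Fin 2) (ZMod ℓ)) := by
          rw [h1, ← smul_smul, sub_smul, one_smul, neg_add_eq_sub]
  have hno : ∀ l : ZMod ℓ, l ^ 2 - t.trace * l + t.det ≠ 0 := by
    intro l hl
    rw [hdet.1, hdet.2, zero_mul, sub_zero] at hl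
    exact hℓ ⟨l, by linear_combination -hl⟩
  have hk : IsField (adjoinElem t) := isField_adjoinElem hno
  have h2 : Module.finrank (ZMod ℓ) (adjoinElem t) = 2 := finrank_adjoinElem hts
  -- invertibility of the `g_σ`
  have hgu : ∀ σ : Field.absoluteGaloisGroup ℚ,
      IsUnit ((Φ (galoisRepTorsion W ℓ σ) : GL (Fin 2) (ZMod ℓ)) :
        Matrix (Fin 2) (Fin 2) (ZMod ℓ)).det := fun σ ↦ by
    rw [← Matrix.GeneralLinearGroup.val_det_apply]; exact Units.isUnit _
  -- every `g_σ` conjugates `t` to `±t`, so `𝔽_ℓ[g_σ t g_σ⁻¹] = 𝔽_ℓ[t]`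
  have key : ∀ σ : Field.absoluteGaloisGroup ℚ,
      adjoinElem (((Φ (galoisRepTorsion W ℓ σ) : GL (Fin 2) (ZMod ℓ)) :
          Matrix (Fin 2) (Fin 2) (ZMod ℓ)) * t *
        (((Φ (galoisRepTorsion W ℓ σ) : GL (Fin 2) (ZMod ℓ)) :
          Matrix (Fin 2) (Fin 2) (ZMod ℓ)))⁻¹) = adjoinElem t := by
    intro σ
    rcases hσu σ with hσ | hσ
    · rw [hcomm σ hσ, Matrix.mul_assoc, Matrix.mul_nonsing_inv _ (hgu σ), Matrix.mul_one]
    · rw [hanti σ hσ, neg_mul, Matrix.mul_assoc, Matrix.mul_nonsing_inv _ (hgu σ), Matrix.mul_one]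
      exact adjoinElem_eq_of_mem ⟨0, -1, by simp⟩
        fun c hc ↦ hts (-c) (by rw [neg_smul, ← hc, neg_neg])
  refine ⟨adjoinElem t, hk, h2, ?_, ?_⟩
  · rintro g ⟨g', ⟨σ, rfl⟩, rfl⟩
    rw [MulEquiv.coe_toMonoidHom, Subgroup.mem_normalizer_iff]
    intro h
    simp only [mem_unitGroup_iff, Units.val_mul, Matrix.coe_units_inv]
    constructor
    · intro hh
      have := conj_mem_adjoinElem hh (Matrix.mul_nonsing_inv _ (hgu σ))
      rwa [key σ] at this
    · intro hh
      have := conj_mem_adjoinElem hh (Matrix.nonsing_inv_mul _ (hgu σ))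
      rw [conj_cancel' _ (hgu σ)] at this
      have key' := key σ⁻¹
      simp only [map_inv, Matrix.coe_units_inv, Matrix.nonsing_inv_nonsing_inv _ (hgu σ)] at key'
      rwa [key'] at this
  · intro σ hσ
    rw [mem_unitGroup_iff]
    obtain ⟨a, b, hab⟩ :=
      DeligneSerre1974.TwoByTwo.exists_eq_smul_one_add_smul_of_commute hts (hcomm σ hσ).symm
    exact ⟨a, b, hab⟩

end Abstract

/-! ### Darmon–Merel Prop. 4.1 (1), containment, for `y² = x³ + Dx` and `ℓ ≡ 3 (mod 4)` -/

section QuarticImage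

variable {D : ℚ}

/-- **Darmon–Merel 1997, Prop. 4.1 (1) (containment, non-split case), for every frame.** For
`E_D : y² = x³ + Dx` over `ℚ`, a prime `ℓ` with `−1` a non-square in `𝔽_ℓ` (`ℓ ≡ 3 (mod 4)`), and
any frame `(e, Φ)` of `E_D[ℓ]`: there are `u = i ∈ ℚ̄` (`u² = −1`) and a subalgebra
`k = 𝔽_ℓ[t] ⊆ M₂(𝔽_ℓ)` which is a field of degree `2` — so that `kˣ` is a non-split Cartan
subgroup (`Serre1972.unitGroup_mem_cartanSubgroups`) — with
`Φ(ρ̄_{E_D,ℓ}(Gal(ℚ̄/ℚ))) ⊆ N(kˣ)` and `Φ(ρ̄(σ)) ∈ kˣ` whenever `σ(i) = i` ("the group `G` is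
[here: is contained in] the normalizer of a Cartan subgroup … non-split if `p ≡ −1 (mod 4)`.
Moreover, the field cut out by `ρ` is an abelian extension of `ℚ(i)`"). From
`exists_cmAut_quartic` and `exists_unitGroup_of_cmAut`. [cite: DarmonMerel1997, Prop. 4.1 (1)] -/
theorem exists_unitGroup_quartic (ℓ : ℕ) [Fact ℓ.Prime] (hℓ : ¬ IsSquare (-1 : ZMod ℓ))
    (e : geomTorsion (⟨0, 0, 0, D, 0⟩ : WeierstrassCurve ℚ) ℓ ≃+ (Fin 2 → ZMod ℓ))
    (Φ : Multiplicative (AddAut (geomTorsion (⟨0, 0, 0, D, 0⟩ : WeierstrassCurve ℚ) ℓ)) ≃*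
      GL (Fin 2) (ZMod ℓ))
    (heΦ : ∀ (g : Multiplicative (AddAut (geomTorsion (⟨0, 0, 0, D, 0⟩ : WeierstrassCurve ℚ) ℓ)))
      (x : geomTorsion (⟨0, 0, 0, D, 0⟩ : WeierstrassCurve ℚ) ℓ),
      e (Multiplicative.toAdd g x) =
        ((Φ g : GL (Fin 2) (ZMod ℓ)) : Matrix (Fin 2) (Fin 2) (ZMod ℓ)) *ᵥ e x) :
    ∃ u : (AlgebraicClosure ℚ), u ^ 2 = -1 ∧ ∃ k : Subalgebra (ZMod ℓ) (Matrix (Fin 2) (Fin 2) (ZMod ℓ)),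
      IsField k ∧ Module.finrank (ZMod ℓ) k = 2 ∧
      (galoisRepTorsion (⟨0, 0, 0, D, 0⟩ : WeierstrassCurve ℚ) ℓ).range.map Φ.toMonoidHom ≤
        Subgroup.normalizer (unitGroup k : Set (GL (Fin 2) (ZMod ℓ))) ∧
      ∀ σ : Field.absoluteGaloisGroup ℚ, σ • u = u →
        Φ (galoisRepTorsion (⟨0, 0, 0, D, 0⟩ : WeierstrassCurve ℚ) ℓ σ) ∈ unitGroup k := by
  obtain ⟨u, hu⟩ := IsAlgClosed.exists_pow_nat_eq (-1 : AlgebraicClosure ℚ) (n := 2) two_pos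
  obtain ⟨ι, hιι, hfix, hneg⟩ := exists_cmAut_quartic (D := D) hu
  exact ⟨u, hu, exists_unitGroup_of_cmAut _ ℓ hℓ (smul_sqrt_neg_one_eq_or hu) ι hιι hfix hneg
    e Φ heΦ⟩

/-- **Darmon–Merel 1997, Prop. 4.1 (1) (containment, non-split case).** For `D ≠ 0` and a prime
`ℓ` with `−1` a non-square in `𝔽_ℓ`, there is a frame `(e, Φ)` of `E_D[ℓ]`, `E_D : y² = x³ + Dx`
(`SerreOpenImageDeterminantProofs.exists_frame_galoisRepTorsion_rat`), in which the image of
`ρ̄_{E_D,ℓ}` is contained in the normaliser of the non-split Cartan subgroup `kˣ`, `k = 𝔽_ℓ[t]` a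
field of degree `2`, with `ρ̄(σ) ∈ kˣ` for all `σ` fixing `i`. (For `D = −1` this is the curve
`X₀(32) : Y² = X³ − X` of the source; the equality `G = N(kˣ)` of the source is not asserted.)
[cite: DarmonMerel1997, Prop. 4.1 (1)] -/
theorem exists_frame_unitGroup_quartic (hD : D ≠ 0) (ℓ : ℕ) [Fact ℓ.Prime]
    (hℓ : ¬ IsSquare (-1 : ZMod ℓ)) :
    ∃ (e : geomTorsion (⟨0, 0, 0, D, 0⟩ : WeierstrassCurve ℚ) ℓ ≃+ (Fin 2 → ZMod ℓ))
      (Φ : Multiplicative (AddAut (geomTorsion (⟨0, 0, 0, D, 0⟩ : WeierstrassCurve ℚ) ℓ)) ≃*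
        GL (Fin 2) (ZMod ℓ)),
      (∀ (g : Multiplicative (AddAut (geomTorsion (⟨0, 0, 0, D, 0⟩ : WeierstrassCurve ℚ) ℓ)))
        (x : geomTorsion (⟨0, 0, 0, D, 0⟩ : WeierstrassCurve ℚ) ℓ),
        e (Multiplicative.toAdd g x) =
          ((Φ g : GL (Fin 2) (ZMod ℓ)) : Matrix (Fin 2) (Fin 2) (ZMod ℓ)) *ᵥ e x) ∧
      ∃ u : (AlgebraicClosure ℚ), u ^ 2 = -1 ∧ ∃ k : Subalgebra (ZMod ℓ) (Matrix (Fin 2) (Fin 2) (ZMod ℓ)),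
        IsField k ∧ Module.finrank (ZMod ℓ) k = 2 ∧
        (galoisRepTorsion (⟨0, 0, 0, D, 0⟩ : WeierstrassCurve ℚ) ℓ).range.map Φ.toMonoidHom ≤
          Subgroup.normalizer (unitGroup k : Set (GL (Fin 2) (ZMod ℓ))) ∧
        ∀ σ : Field.absoluteGaloisGroup ℚ, σ • u = u →
          Φ (galoisRepTorsion (⟨0, 0, 0, D, 0⟩ : WeierstrassCurve ℚ) ℓ σ) ∈ unitGroup k := by
  haveI := isElliptic_quartic hD
  obtain ⟨e, Φ, heΦ, -, -⟩ :=
    exists_frame_galoisRepTorsion_rat (⟨0, 0, 0, D, 0⟩ : WeierstrassCurve ℚ) ℓ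
  exact ⟨e, Φ, heΦ, exists_unitGroup_quartic ℓ hℓ e Φ heΦ⟩

/-- Elements of the unit group of a subalgebra `k ⊆ M₂(F)` which is a field commute. [folklore] -/
theorem mul_comm_of_mem_unitGroup_of_isField {F : Type*} [Field F]
    {k : Subalgebra F (Matrix (Fin 2) (Fin 2) F)} (hk : IsField k) {g h : GL (Fin 2) F}
    (hg : g ∈ unitGroup k) (hh : h ∈ unitGroup k) : g * h = h * g := by
  have e := congrArg Subtype.val (hk.mul_comm ⟨(g : Matrix (Fin 2) (Fin 2) F), hg⟩ ⟨h, hh⟩)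
  exact Units.ext (by simpa using e)

/-- **"Moreover, the field cut out by `ρ` is an abelian extension of `ℚ(i)`"** (Darmon–Merel 1997,
Prop. 4.1 (1), last clause), for `E_D : y² = x³ + Dx` (`D ≠ 0`) and a prime `ℓ` with `−1` a
non-square in `𝔽_ℓ`, frame-free: `ρ̄_{E_D,ℓ}(σ)` and `ρ̄_{E_D,ℓ}(τ)` commute for all `σ, τ` fixing
`i` (both lie in the commutative Cartan subgroup `kˣ` of `exists_frame_unitGroup_quartic`).
[cite: DarmonMerel1997, Prop. 4.1 (1)] -/
theorem galoisRepTorsion_quartic_comm_of_smul_eq (hD : D ≠ 0) (ℓ : ℕ) [Fact ℓ.Prime]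
    (hℓ : ¬ IsSquare (-1 : ZMod ℓ)) :
    ∃ u : AlgebraicClosure ℚ, u ^ 2 = -1 ∧ ∀ σ τ : Field.absoluteGaloisGroup ℚ,
      σ • u = u → τ • u = u →
        galoisRepTorsion (⟨0, 0, 0, D, 0⟩ : WeierstrassCurve ℚ) ℓ σ *
            galoisRepTorsion (⟨0, 0, 0, D, 0⟩ : WeierstrassCurve ℚ) ℓ τ =
          galoisRepTorsion (⟨0, 0, 0, D, 0⟩ : WeierstrassCurve ℚ) ℓ τ *
            galoisRepTorsion (⟨0, 0, 0, D, 0⟩ : WeierstrassCurve ℚ) ℓ σ := by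
  obtain ⟨e, Φ, -, u, hu, k, hk, -, -, hmem⟩ := exists_frame_unitGroup_quartic hD ℓ hℓ
  refine ⟨u, hu, fun σ τ hσ hτ ↦ Φ.injective ?_⟩
  rw [map_mul, map_mul]
  exact mul_comm_of_mem_unitGroup_of_isField hk (hmem σ hσ) (hmem τ hτ)

/-- `exists_frame_unitGroup_quartic` under the congruence hypothesis of the source,
`ℓ ≡ 3 (mod 4)` ("non-split if `p ≡ −1 (mod 4)`"): then `−1` is not a square mod `ℓ`
(Mathlib `ZMod.exists_sq_eq_neg_one_iff`, the first supplement to quadratic reciprocity).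
[cite: DarmonMerel1997, Prop. 4.1 (1)] -/
theorem exists_frame_unitGroup_quartic_of_mod_four (hD : D ≠ 0) (ℓ : ℕ) [Fact ℓ.Prime]
    (hℓ : ℓ % 4 = 3) :
    ∃ (e : geomTorsion (⟨0, 0, 0, D, 0⟩ : WeierstrassCurve ℚ) ℓ ≃+ (Fin 2 → ZMod ℓ))
      (Φ : Multiplicative (AddAut (geomTorsion (⟨0, 0, 0, D, 0⟩ : WeierstrassCurve ℚ) ℓ)) ≃*
        GL (Fin 2) (ZMod ℓ)),
      (∀ (g : Multiplicative (AddAut (geomTorsion (⟨0, 0, 0, D, 0⟩ : WeierstrassCurve ℚ) ℓ)))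
        (x : geomTorsion (⟨0, 0, 0, D, 0⟩ : WeierstrassCurve ℚ) ℓ),
        e (Multiplicative.toAdd g x) =
          ((Φ g : GL (Fin 2) (ZMod ℓ)) : Matrix (Fin 2) (Fin 2) (ZMod ℓ)) *ᵥ e x) ∧
      ∃ u : AlgebraicClosure ℚ, u ^ 2 = -1 ∧
        ∃ k : Subalgebra (ZMod ℓ) (Matrix (Fin 2) (Fin 2) (ZMod ℓ)),
        IsField k ∧ Module.finrank (ZMod ℓ) k = 2 ∧
        (galoisRepTorsion (⟨0, 0, 0, D, 0⟩ : WeierstrassCurve ℚ) ℓ).range.map Φ.toMonoidHom ≤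
          Subgroup.normalizer (unitGroup k : Set (GL (Fin 2) (ZMod ℓ))) ∧
        ∀ σ : Field.absoluteGaloisGroup ℚ, σ • u = u →
          Φ (galoisRepTorsion (⟨0, 0, 0, D, 0⟩ : WeierstrassCurve ℚ) ℓ σ) ∈ unitGroup k :=
  exists_frame_unitGroup_quartic hD ℓ fun h ↦ (ZMod.exists_sq_eq_neg_one_iff.mp h) hℓ

end QuarticImage

end WeierstrassCurve
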